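import Mathlib
import Literature.LinearAlgebra.Matrix.CrossInterpolation
import Literature.LinearAlgebra.Matrix.RankMinors
import Literature.LinearAlgebra.Matrix.AdaptiveCrossApproximation
import Literature.LinearAlgebra.Matrix.CrossPivotInverseGrowth
import Literature.LinearAlgebra.Matrix.PosSemidefCrossApproximation

/-!
# A-priori error bound for cross approximation of SPSD matrices with diagonal pivoting

For a real symmetric positive semidefinite matrix `A` and a DIAGONALLY PIVOTED sequence
`r : Fin k → n` (`IsDiagPivoted A r`: adaptive cross approximation with diagonal = complete
pivoting, i.e. `k` steps of the Cholesky / `LDLᵀ` algorithm with symmetric pivoting,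
[GolubVanLoan2013, Algorithm 4.2.2]) the cross approximation `Ã = crossInterp A r r` satisfies the
a-priori bound in the Chebyshev norm

  `‖A - Ã‖_max ≤ (4^{k+1} - 1)/3 · γ_k(A) ≤ 2^{2k+1} · γ_k(A)`,
  `γ_k(A) = min {‖A - F‖_max : rank F ≤ k}`

(`IsDiagPivoted.abs_sub_crossInterp_le_of_rank_le`, stated against an arbitrary matrix `F` of
rank `≤ k` with `|A i j - F i j| ≤ δ`).  This is [CortinovisKressnerMassei2020, Theorem 7]
(`‖A - Ã‖_max ≤ 2^{2m+1} ρ_m γ_m(A)` under complete pivoting) in the SPSD case, where the pivots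
are non-increasing so that the growth factor is `ρ_m = 1` [CortinovisKressnerMassei2020, §3.2] —
the Chebyshev-norm form of the bound `‖A - Ã‖_max ≤ 4^m σ_{m+1}(A)` of Harbrecht–Peters–Schneider
for the pivoted Cholesky decomposition [CortinovisKressnerMassei2020, Corollary 8];
[HarbrechtPetersSchneider2012] (`γ_m(A) ≤ σ_{m+1}(A)`).  The constant `(4^{k+1} - 1)/3` produced by
the entry-sum bookkeeping below is slightly smaller than the printed `2^{2k+1}`.

The proof follows [CortinovisKressnerMassei2020, §3.1–§3.2]:
* along a diagonally pivoted sequence the pivots `d₁ ≥ d₂ ≥ ⋯` are non-increasing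
  (`IsDiagPivoted.pivot_le_pivot`; [GolubVanLoan2013, Algorithm 4.2.2];
  [CortinovisKressnerMassei2020, §3.2]), hence the entry sum of the inverse pivot block obeys
  `Σ_{a,b} |A[r, r]⁻¹ a b| ≤ (4^k - 1) / (3 d_k)`, `d_k` the last (smallest) pivot
  (`IsDiagPivoted.sum_abs_inv_submatrix_le`, iterating
  `IsRookPivoted.sum_norm_inv_submatrix_vecCons_vecCons_le` of `CrossPivotInverseGrowth`);
* if `rank F ≤ k` then the `(k+1) × (k+1)` block of `F` on the first `k + 1` pivots is singular,
  so the distance-to-singularity inequality (`one_le_mul_sum_norm_inv_of_det_eq_zero`) gives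
  `d_{k+1} ≤ (4^{k+1} - 1)/3 · ‖A - F‖_max` (`IsDiagPivoted.pivot_le_of_rank_le`);
* `d_{k+1}` is the largest diagonal entry of the PSD residual after `k` steps and therefore
  bounds all its entries (`abs_sub_crossInterp_le_pivot_of_forall_diag_le` of
  `PosSemidefCrossApproximation`); if no `(k+1)`-st pivot exists the residual vanishes.

NOT formalised: singular values (`σ_{m+1}`, Corollary 8 as printed, Corollaries 9–10 on the
trace / nuclear norm), the growth factor `ρ_m` and Theorems 6–7 for general matrices, the
asymptotic tightness [CortinovisKressnerMassei2020, §3.2], decay-rate consequences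
[HarbrechtPetersSchneider2012].

References: S. Cortinovis, D. Kressner, S. Massei, *On maximum volume submatrices and cross
approximation for symmetric semidefinite and diagonally dominant matrices*, Linear Algebra
Appl. 593 (2020) 251–268 (theorem numbering of arXiv:1902.02283); H. Harbrecht, M. Peters,
R. Schneider, *On the low-rank approximation by the pivoted Cholesky decomposition*, Appl. Numer.
Math. 62 (2012) 428–440 (cited as attributed in [CortinovisKressnerMassei2020, §3.2]; not held);
G. H. Golub, C. F. Van Loan, *Matrix Computations*, 4th ed., 2013, §4.2.7–§4.2.8.
AI-produced formalisation (H21 engines group, seat eng-quad-2, 2026-08-21); no facts, no axioms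
beyond Mathlib's, no `sorry`.
-/

open Matrix Finset

namespace Literature.LinearAlgebra.Matrix

variable {n : Type*} [Fintype n] {A : Matrix n n ℝ} {k : ℕ}

omit [Fintype n] in
/-- [cite: GolubVanLoan2013, §4.2.7 Algorithm 4.2.2 (the pivot maximises the current diagonal)]
Inversion of a diagonally pivoted sequence at its newest pivot: the residual before the last
step is nonzero at the pivot and maximal there along the diagonal. -/
theorem IsDiagPivoted.ne_zero_and_forall_le {r : Fin k → n} {p : n}
    (h : IsDiagPivoted A (vecCons p r)) :
    (A - crossInterp A r r) p p ≠ 0 ∧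
      ∀ x, (A - crossInterp A r r) x x ≤ (A - crossInterp A r r) p p := by
  generalize hr : vecCons p r = r' at h
  cases h with
  | @cons k' r₀ p₀ h₀ hne hmax =>
    have hp : p = p₀ := by simpa using congr_fun hr 0
    have hr0 : r = r₀ := by funext t; simpa using congr_fun hr t.succ
    subst hp hr0
    exact ⟨hne, hmax⟩

omit [Fintype n] in
/-- [cite: GolubVanLoan2013, §4.2.7 Algorithm 4.2.2 (`IsDiagPivoted (vecCons p r)` restricts to
`IsDiagPivoted r`)] The older pivots of a diagonally pivoted sequence are diagonally pivoted. -/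
theorem IsDiagPivoted.tail {r : Fin k → n} {p : n} (h : IsDiagPivoted A (vecCons p r)) :
    IsDiagPivoted A r := by
  generalize hr : vecCons p r = r' at h
  cases h with
  | @cons k' r₀ p₀ h₀ hne hmax =>
    have hr0 : r = r₀ := by funext t; simpa using congr_fun hr t.succ
    subst hr0
    exact h₀

/-- [cite: GolubVanLoan2013, §4.2.7 Algorithm 4.2.2 ("`d₁ ≥ d₂ ≥ ⋯ ≥ d_n`"), §4.2.8 (4.2.16)];
[cite: CortinovisKressnerMassei2020, §3.2 ("in the SPSD case, the pivot elements … are always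
non-increasing", so `ρ_k = 1`)] THE PIVOTS ARE NON-INCREASING: along a diagonally pivoted
sequence on an SPSD matrix, the pivot value of the newest step, `(A - Ã_{(p₀, r)}) p p`, is at
most the previous pivot value `(A - Ã_r) p₀ p₀`. -/
theorem IsDiagPivoted.pivot_le_pivot (hA : A.PosSemidef) {r : Fin k → n} {p₀ p : n}
    (h : IsDiagPivoted A (vecCons p (vecCons p₀ r))) :
    (A - crossInterp A (vecCons p₀ r) (vecCons p₀ r)) p p ≤ (A - crossInterp A r r) p₀ p₀ := by
  obtain ⟨hne₀, hmax₀⟩ := h.tail.ne_zero_and_forall_le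
  exact sub_crossInterp_vecCons_self_diag_le_pivot hA r (h.tail.tail.isUnit_det hA) hne₀ hmax₀ p

/-- [cite: CortinovisKressnerMassei2020, §3.1 (proof of Theorem 7: `‖A₁₁⁻¹‖ ≤ 2^{2m+1} /
min{|p_1|, …, |p_{m+1}|}`), §3.2 (SPSD: pivots non-increasing, `ρ = 1`)] GROWTH OF THE INVERSE
PIVOT BLOCK UNDER PIVOTED CHOLESKY: for a diagonally pivoted sequence of `k + 1` pivots on an SPSD
matrix with last (= smallest) pivot value `d = (A - Ã_r) p p`,
`Σ_{a,b} |A[(p, r), (p, r)]⁻¹ a b| ≤ (4^{k+1} - 1) / (3 d)`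
(the sum `Σ_t 4^t / d_{t+1}` of the one-step recursion, bounded using `d_{t+1} ≥ d`). -/
theorem IsDiagPivoted.sum_abs_inv_submatrix_le (hA : A.PosSemidef) :
    ∀ {k : ℕ} {r : Fin k → n} {p : n}, IsDiagPivoted A (vecCons p r) →
      ∑ a, ∑ b, |(A.submatrix (vecCons p r) (vecCons p r))⁻¹ a b| ≤
        (4 ^ (k + 1) - 1) / (3 * (A - crossInterp A r r) p p) := by
  intro k
  induction k with
  | zero =>
    intro r p h
    obtain ⟨hne, hmax⟩ := h.ne_zero_and_forall_le
    have hpos : 0 < (A - crossInterp A r r) p p :=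
      lt_of_le_of_ne (sub_crossInterp_diag_nonneg hA r (h.tail.isUnit_det hA) p) hne.symm
    have h1 := (h.tail.isRookPivoted hA).sum_norm_inv_submatrix_vecCons_vecCons_le hne
    simp only [Real.norm_eq_abs, Finset.univ_eq_empty, Finset.sum_empty, zero_add, pow_zero,
      abs_of_pos hpos] at h1
    refine h1.trans (le_of_eq ?_)
    field_simp
    norm_num
  | succ k ih =>
    intro r p h
    obtain ⟨hne, hmax⟩ := h.ne_zero_and_forall_le
    have hpos : 0 < (A - crossInterp A r r) p p :=
      lt_of_le_of_ne (sub_crossInterp_diag_nonneg hA r (h.tail.isUnit_det hA) p) hne.symm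
    have h1 := (h.tail.isRookPivoted hA).sum_norm_inv_submatrix_vecCons_vecCons_le hne
    simp only [Real.norm_eq_abs, abs_of_pos hpos] at h1
    -- the older sequence `r = (p₀, r₀)` : induction hypothesis and monotonicity of the pivots
    have htail := h.tail
    cases htail with
    | @cons k' r₀ p₀ h₀ hne₀ hmax₀ =>
      have h2 := ih h.tail
      have hmono := h.pivot_le_pivot hA
      have hpos₀ : 0 < (A - crossInterp A r₀ r₀) p₀ p₀ := lt_of_lt_of_le hpos hmono
      have h3 : ((4 : ℝ) ^ (k + 1) - 1) / (3 * (A - crossInterp A r₀ r₀) p₀ p₀) ≤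
          (4 ^ (k + 1) - 1) / (3 * (A - crossInterp A (vecCons p₀ r₀) (vecCons p₀ r₀)) p p) := by
        apply div_le_div_of_nonneg_left _ (by positivity) (by linarith)
        have : (1 : ℝ) ≤ 4 ^ (k + 1) := one_le_pow₀ (by norm_num)
        linarith
      refine (h1.trans (add_le_add (h2.trans h3) le_rfl)).trans (le_of_eq ?_)
      rw [pow_succ, pow_succ]
      field_simp
      ring

/-- [cite: CortinovisKressnerMassei2020, §3.1 (proof of Theorem 7: "`min{|p_1|, …, |p_{m+1}|} ≤
2^{2m+1} ‖A₁₁⁻¹‖⁻¹_{∞→1} = 2^{2m+1} γ_m(A₁₁) ≤ 2^{2m+1} γ_m(A)`"), §3.2 (SPSD: the minimum is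
the last pivot)] THE `(k+1)`-ST PIVOT IS CONTROLLED BY THE RANK-`k` CHEBYSHEV DISTANCE: if
`(p, r)` is a diagonally pivoted sequence of `k + 1` pivots on an SPSD matrix `A` and `F` is any
matrix of rank `≤ k` with `|A i j - F i j| ≤ δ`, then the pivot value satisfies
`(A - Ã_r) p p ≤ (4^{k+1} - 1)/3 · δ`. -/
theorem IsDiagPivoted.pivot_le_of_rank_le (hA : A.PosSemidef) {r : Fin k → n} {p : n}
    (h : IsDiagPivoted A (vecCons p r)) (F : Matrix n n ℝ) (hF : F.rank ≤ k) {δ : ℝ}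
    (hδ : ∀ i j, |A i j - F i j| ≤ δ) :
    (A - crossInterp A r r) p p ≤ (4 ^ (k + 1) - 1) / 3 * δ := by
  obtain ⟨hne, hmax⟩ := h.ne_zero_and_forall_le
  have hpos : 0 < (A - crossInterp A r r) p p :=
    lt_of_le_of_ne (sub_crossInterp_diag_nonneg hA r (h.tail.isUnit_det hA) p) hne.symm
  have hP : IsUnit (A.submatrix (vecCons p r) (vecCons p r)).det := h.isUnit_det hA
  have hFdet : (F.submatrix (vecCons p r) (vecCons p r)).det = 0 :=
    det_submatrix_eq_zero_of_rank_lt_card F _ _ (by simp; omega)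
  have hdist := one_le_mul_sum_norm_inv_of_det_eq_zero hP hFdet
    (δ := δ) (fun a b => by simpa [Real.norm_eq_abs] using hδ _ _)
  simp only [Real.norm_eq_abs] at hdist
  have hsum := h.sum_abs_inv_submatrix_le hA
  have hδ0 : 0 ≤ δ := (abs_nonneg _).trans (hδ p p)
  have h1 : 1 ≤ δ * ((4 ^ (k + 1) - 1) / (3 * (A - crossInterp A r r) p p)) :=
    hdist.trans (mul_le_mul_of_nonneg_left hsum hδ0)
  rw [← mul_div_assoc, le_div_iff₀ (by positivity), one_mul] at h1
  linarith

/-- [cite: CortinovisKressnerMassei2020, §3.1 Theorem 7 (`‖A - A(:,J) A(I,J)⁻¹ A(I,:)‖_max ≤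
2^{2m+1} ρ_m γ_m(A)` under complete pivoting), §3.2 Corollary 8 (SPSD: `ρ_m = 1`;
`‖A - Ã‖_max ≤ 4^m σ_{m+1}(A)`, due to Harbrecht–Peters–Schneider)];
[cite: HarbrechtPetersSchneider2012, (pivoted Cholesky error bound, as attributed in
CortinovisKressnerMassei2020 §3.2)] THE A-PRIORI ERROR BOUND FOR CROSS APPROXIMATION OF AN
SPSD MATRIX WITH DIAGONAL (= COMPLETE) PIVOTING, Chebyshev form: after `k` diagonally pivoted
steps, `|(A - Ã) x y| ≤ (4^{k+1} - 1)/3 · δ` for every matrix `F` of rank `≤ k` with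
`|A i j - F i j| ≤ δ` — i.e. `‖A - Ã‖_max ≤ (4^{k+1} - 1)/3 · γ_k(A)`. -/
theorem IsDiagPivoted.abs_sub_crossInterp_le_of_rank_le (hA : A.PosSemidef) {r : Fin k → n}
    (h : IsDiagPivoted A r) (F : Matrix n n ℝ) (hF : F.rank ≤ k) {δ : ℝ}
    (hδ : ∀ i j, |A i j - F i j| ≤ δ) (x y : n) :
    |(A - crossInterp A r r) x y| ≤ (4 ^ (k + 1) - 1) / 3 * δ := by
  have hδ0 : 0 ≤ δ := (abs_nonneg _).trans (hδ x y)
  by_cases hex : crossInterp A r r = A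
  · rw [hex, sub_self, Matrix.zero_apply, abs_zero]
    have : (1 : ℝ) ≤ 4 ^ (k + 1) := one_le_pow₀ (by norm_num)
    exact mul_nonneg (by linarith) hδ0
  · obtain ⟨p, hp⟩ := h.exists_cons hA hex
    obtain ⟨hne, hmax⟩ := hp.ne_zero_and_forall_le
    exact (abs_sub_crossInterp_le_pivot_of_forall_diag_le hA r (h.isUnit_det hA) hmax x y).trans
      (hp.pivot_le_of_rank_le hA F hF hδ)

/-- [cite: CortinovisKressnerMassei2020, §3.1 Theorem 7, §3.2 Corollary 8 (with the printed
constant `2^{2m+1} ρ_m`, `ρ_m = 1`)]; [cite: HarbrechtPetersSchneider2012, (as attributed in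
CortinovisKressnerMassei2020 §3.2)] The same bound with the printed growth constant:
`|(A - Ã) x y| ≤ 2^{2k+1} · δ` (`(4^{k+1} - 1)/3 ≤ 2 · 4^k`). -/
theorem IsDiagPivoted.abs_sub_crossInterp_le_two_pow_mul_of_rank_le (hA : A.PosSemidef)
    {r : Fin k → n} (h : IsDiagPivoted A r) (F : Matrix n n ℝ) (hF : F.rank ≤ k) {δ : ℝ}
    (hδ : ∀ i j, |A i j - F i j| ≤ δ) (x y : n) :
    |(A - crossInterp A r r) x y| ≤ 2 ^ (2 * k + 1) * δ := by
  have hδ0 : 0 ≤ δ := (abs_nonneg _).trans (hδ x y)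
  refine (h.abs_sub_crossInterp_le_of_rank_le hA F hF hδ x y).trans
    (mul_le_mul_of_nonneg_right ?_ hδ0)
  have h4 : (4 : ℝ) ^ (k + 1) = 4 * (2 ^ k * 2 ^ k) := by
    rw [pow_succ, ← mul_pow]; norm_num; ring
  have h2 : (2 : ℝ) ^ (2 * k + 1) = 2 * (2 ^ k * 2 ^ k) := by
    rw [pow_succ, two_mul, pow_add]; ring
  rw [h4, h2]
  have : (0 : ℝ) ≤ 2 ^ k * 2 ^ k := by positivity
  linarith

end Literature.LinearAlgebra.Matrix
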